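import Mathlib
import Summits.MatrixMultiplication.MatrixMultiplication.Theses.FourierTwoFamiliesModP
import Summits.MatrixMultiplication.MatrixMultiplication.Theorems.FourierTwoFamiliesModPPrimeTwoFamiliesCapacityEquivalences

/-!
# Paley-pattern gadgets + full Paley Sperner capacity ⟹ `PrimeTwoFamilies`
# (crux stmt-MatrixMultiplication-14308, line `paley-pattern-capacity`, strategist s2, 2026-08-17)

The PATTERN AXIS of the capacity form of the crux (CKSU 2005 §7 charts; landed
`CapacityLift.capacityGadgets_iff_primeTwoFamilies`): a level gadget of direct pairs in `ℤ/m` carries a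
strong-separation digraph, and its zero-error codes are Sperner-capacity codes of that digraph.  Complete and
transitive patterns are the crux itself; for the PALEY TOURNAMENT `P_q` (`q ≡ 3 mod 4`; `σ → τ` iff `τ − σ` is a
non-zero square) the realisation and the capacity requirements separate into two statements, neither of which
is the crux, whose conjunction gives it:

* (hP) PALEY-PATTERN GADGETS — for every `ε > 0`, arbitrarily large `m`, a prime `q ≡ 3 (4)` with
  `m^{1/2-ε} ≤ q` and `q` direct pairs in `ZMod m` of co-volume `≥ m^{1-ε}`, letter `σ` strongly separated
  towards `τ` whenever `τ − σ` is a square (`σ ≠ τ`);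
* (hQ) PALEY SPERNER CAPACITY FULL IN EXPONENT — for every `ε > 0` and all large primes `q ≡ 3 (4)`, a word
  length `L ≥ 1` and `≥ q^{(1-ε)L}` words `Fin L → Fin q` every ordered pair of which has a coordinate `t`
  with `w t − u t` a non-zero square (open in print between `½ log q` and `log((q+1)/2)`: Alon 1998,
  Sali–Simonyi 1999, Blokhuis 1993).

`PrimeTwoFamilies_of_paley : hP → hQ → PrimeTwoFamilies`: the code of (hQ) over the gadget of (hP) is a
zero-error code of size `q^{(1-ε/2)L} ≥ (m^{1/2-ε/2})^{(1-ε/2)L} ≥ (m^L)^{1/2-ε}`, so the hypothesis of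
`capacityGadgets_iff_primeTwoFamilies` holds.  Sorry-free; both hypotheses are the registered stubs
`stub_paleyGadgets`, `stub_paleyCapacity` of the line (skeleton OK 2026-08-17).
-/

-- single-conjunct summit: the mandated namespace repeats `MatrixMultiplication`.
set_option linter.dupNamespace false

namespace Summit.MatrixMultiplication.MatrixMultiplication.Theorems.PrimeTwoFamilies.PaleyPatternCapacity

open Finset
open Summit.MatrixMultiplication.MatrixMultiplication.Theses
open Summit.MatrixMultiplication.MatrixMultiplication.Theorems

/-- **Paley-pattern gadgets + full Paley capacity ⟹ the crux** (the composition of line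
`paley-pattern-capacity`, Cruxes/PrimeTwoFamilies/Lines/paley_pattern_capacity.lean, made citable; usable as
`route edit --split PrimeTwoFamilies --into … --glue-by` should the route's planner adopt the split).  The Sperner code of stub 2 over the
gadget of stub 1 is a zero-error code (`u t → w t` in `P_q` gives strong separation of letter `u t` towards
`w t`), of size `q^{(1-ε/2)L} ≥ (m^{1/2-ε/2})^{(1-ε/2)L} ≥ (m^L)^{1/2-ε}`; the landed equivalence
`CapacityLift.capacityGadgets_iff_primeTwoFamilies` (p99109) turns the capacity gadgets into the crux. -/
theorem PrimeTwoFamilies_of_paley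
    (hP : ∀ ε : ℝ, 0 < ε → ∀ m₀ : ℕ, ∃ m ≥ m₀, ∃ q : ℕ, q.Prime ∧ q % 4 = 3 ∧
      (m : ℝ) ^ (1 / 2 - ε) ≤ (q : ℝ) ∧
      ∃ P Q : Fin q → Finset (ZMod m),
      (∀ c : Fin q, ∀ x ∈ P c, ∀ x' ∈ P c, ∀ y ∈ Q c, ∀ y' ∈ Q c,
          (x - x') + (y - y') = 0 → x = x' ∧ y = y') ∧
      (∀ σ τ : Fin q, σ ≠ τ → IsSquare (((τ : ℕ) : ZMod q) - ((σ : ℕ) : ZMod q)) →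
        ∀ p ∈ P σ, ∀ y ∈ Q τ, ∀ c : Fin q, ∀ p' ∈ P c, ∀ y' ∈ Q c, y - p ≠ y' - p') ∧
      ∀ c : Fin q, (m : ℝ) ^ (1 - ε) ≤ (((P c).card * (Q c).card : ℕ) : ℝ))
    (hQ : ∀ ε : ℝ, 0 < ε → ∃ q₀ : ℕ, ∀ q : ℕ, q₀ ≤ q → q.Prime → q % 4 = 3 →
      ∃ L : ℕ, 1 ≤ L ∧ ∃ W : Finset (Fin L → Fin q),
        (q : ℝ) ^ ((1 - ε) * L) ≤ (W.card : ℝ) ∧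
        ∀ u ∈ W, ∀ w ∈ W, u ≠ w →
          ∃ t : Fin L, u t ≠ w t ∧ IsSquare (((w t : ℕ) : ZMod q) - ((u t : ℕ) : ZMod q))) :
    FourierTwoFamiliesModP.PrimeTwoFamilies := by
  refine PrimeTwoFamilies.CapacityLift.capacityGadgets_iff_primeTwoFamilies.1 ?_
  intro ε hε m₀
  -- work with ε' = min ε (1/4)
  set ε' : ℝ := min ε (1 / 4) with hε'def
  have hε'pos : 0 < ε' := lt_min hε (by norm_num)
  have hε'le : ε' ≤ ε := min_le_left _ _
  have hε'4 : ε' ≤ 1 / 4 := min_le_right _ _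
  -- capacity threshold for ε'/2
  obtain ⟨q₀, hq₀⟩ := hQ (ε' / 2) (by positivity)
  -- a gadget level beyond m₀, 2 and q₀^4, for ε'/2
  obtain ⟨m, hm, q, hq, hq3, hmq, P, Q, hD, hSep, hcov⟩ :=
    hP (ε' / 2) (by positivity) (max m₀ (max 2 (q₀ ^ 4)))
  have hm₀ : m₀ ≤ m := (le_max_left _ _).trans hm
  have hm2 : 2 ≤ m := ((le_max_left _ _).trans (le_max_right _ _)).trans hm
  have hmq₀ : q₀ ^ 4 ≤ m := ((le_max_right _ _).trans (le_max_right _ _)).trans hm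
  have hm1 : (1 : ℝ) ≤ m := by exact_mod_cast (show 1 ≤ m by omega)
  have hm0 : (0 : ℝ) ≤ m := by positivity
  -- the Paley prime is beyond the capacity threshold
  have hqq₀ : q₀ ≤ q := by
    have h1 : ((q₀ : ℝ) ^ (4 : ℕ)) ^ ((4 : ℕ)⁻¹ : ℝ) = (q₀ : ℝ) :=
      Real.pow_rpow_inv_natCast (Nat.cast_nonneg _) (by norm_num)
    have h2 : ((q₀ : ℝ) ^ (4 : ℕ)) ^ ((4 : ℕ)⁻¹ : ℝ) ≤ (m : ℝ) ^ ((4 : ℕ)⁻¹ : ℝ) :=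
      Real.rpow_le_rpow (by positivity) (by exact_mod_cast hmq₀) (by positivity)
    have h3 : (m : ℝ) ^ ((4 : ℕ)⁻¹ : ℝ) ≤ (m : ℝ) ^ (1 / 2 - ε' / 2) := by
      apply Real.rpow_le_rpow_of_exponent_le hm1
      push_cast
      linarith
    have h4 : (q₀ : ℝ) ≤ q := by linarith
    exact_mod_cast h4
  obtain ⟨L, hL, W, hWcard, hCode⟩ := hq₀ q hqq₀ hq hq3
  refine ⟨m, hm₀, q, L, P, Q, W, hD, ?_, hL, ?_, ?_⟩
  · -- the Paley code is a zero-error code over the gadget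
    intro i hi k hk hik
    obtain ⟨t, hne, hsq⟩ := hCode i hi k hk hik
    exact ⟨t, hSep (i t) (k t) hne hsq⟩
  · -- size bookkeeping: (m^L)^{1/2-ε} ≤ q^{(1-ε'/2)L} ≤ |W|
    have hL0 : (0 : ℝ) ≤ L := Nat.cast_nonneg _
    have hexp : (L : ℝ) * (1 / 2 - ε) ≤ (1 / 2 - ε' / 2) * ((1 - ε' / 2) * L) := by
      have key : (1 / 2 - ε) ≤ (1 / 2 - ε' / 2) * (1 - ε' / 2) := by nlinarith
      have := mul_le_mul_of_nonneg_left key hL0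
      linarith [this]
    calc ((m : ℝ) ^ (L : ℝ)) ^ (1 / 2 - ε)
        = (m : ℝ) ^ ((L : ℝ) * (1 / 2 - ε)) := (Real.rpow_mul hm0 _ _).symm
      _ ≤ (m : ℝ) ^ ((1 / 2 - ε' / 2) * ((1 - ε' / 2) * L)) :=
          Real.rpow_le_rpow_of_exponent_le hm1 hexp
      _ = ((m : ℝ) ^ (1 / 2 - ε' / 2)) ^ ((1 - ε' / 2) * L) := Real.rpow_mul hm0 _ _
      _ ≤ (q : ℝ) ^ ((1 - ε' / 2) * L) :=
          Real.rpow_le_rpow (by positivity) hmq (by nlinarith)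
      _ ≤ (W.card : ℝ) := hWcard
  · -- co-volumes: m^{1-ε} ≤ m^{1-ε'/2} ≤ |P c||Q c|
    intro c
    refine le_trans ?_ (hcov c)
    exact Real.rpow_le_rpow_of_exponent_le hm1 (by linarith)


end Summit.MatrixMultiplication.MatrixMultiplication.Theorems.PrimeTwoFamilies.PaleyPatternCapacity
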